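import Literature.AlgebraicGeometry.Frobenioids.ProfiniteUnitsProofs
import Literature.AlgebraicGeometry.Frobenioids.ProfiniteUnitsDecomposition
import HarnessLib

/-!
# Frobenioids I, Definition 2.8 (iii): "raising to the `ζ`-th power" on TORSION — the exponent `Z ≡ ζ(l) (mod l^{v_l(N)})`

Mochizuki, *The geometry of Frobenioids I: the general theory*, Kyushu J. Math. **62** (2008) 293–400, §2,
Definition 2.8 (ii)(iii), kurims p. 52 [cite: MochizukiFrdI2008, Def. 2.8(iii) p.52]: "`M` decomposes as a
direct product of pro-`l` groups `M[l]` … the map `M → M` given by raising to the `ζ(l)`-th power on `M[l]`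
… we shall refer to this map as the map given by *raising to the `ζ`-th power*."

PROOF-ONLY file (abc-iut cell, layer L1, seat abc-iut-w5-d248 gen 3; input for [FrdII] Rmk. 2.4.2 at an
ARBITRARY level `N`). For the predicate `IsZetaPowerMap M ζ f` (abc-iut-L1-t12, `ProfiniteUnits.lean`) and
ANY topology: an element `x` killed by `N ≠ 0` decomposes inside the finite cyclic group it generates as a
product of its `l`-primary components `x^{e_l}` (primary idempotents `e_l` modulo `N`,
`exists_primary_idempotent`), each of which lies in `M[l]`; hence `f x = x^Z` for EVERY `Z : ℕ` with
`Z ≡ ζ(l) (mod l^{v_l(N)})` for all primes `l` (`IsZetaPowerMap.eq_pow_of_pow_eq_one`) — the image of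
`ζ = (ζ(l))_l ∈ ∏_l ℤ_l = Ẑ` in `ℤ/Nℤ`; such a `Z` exists (`exists_modEq_forall_prime`). Classical finite
group theory; nothing here concerns [IUTchIII].
-/

namespace Literature.AlgebraicGeometry.Frobenioids

universe u

variable {M : Type u} [CommGroup M] [TopologicalSpace M] {ζ : Nat.Primes → ℕ+} {f : M → M}

omit [TopologicalSpace M] in
/-- Powers of a torsion element only depend on the exponent modulo any `N` killing it.
[cite: MochizukiFrdI2008, Def. 2.8(ii) p.52] -/
theorem pow_eq_pow_of_modEq_of_pow_eq_one {x : M} {N a b : ℕ} (hx : x ^ N = 1) (h : a ≡ b [MOD N]) :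
    x ^ a = x ^ b :=
  pow_eq_pow_iff_modEq.mpr (h.of_dvd (orderOf_dvd_of_pow_eq_one hx))

/-- A `ζ`-th power map fixes `1` (it is multiplicative on a group). [cite: MochizukiFrdI2008, Def. 2.8(iii) p.52] -/
theorem IsZetaPowerMap.map_one (hf : IsZetaPowerMap M ζ f) : f 1 = 1 :=
  (MonoidHom.mk' f hf.map_mul).map_one

/-- A `ζ`-th power map commutes with natural powers. [cite: MochizukiFrdI2008, Def. 2.8(iii) p.52] -/
theorem IsZetaPowerMap.map_pow (hf : IsZetaPowerMap M ζ f) (x : M) (n : ℕ) : f (x ^ n) = f x ^ n :=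
  (MonoidHom.mk' f hf.map_mul).map_pow x n

/-- A `ζ`-th power map commutes with finite products. [cite: MochizukiFrdI2008, Def. 2.8(iii) p.52] -/
theorem IsZetaPowerMap.map_prod (hf : IsZetaPowerMap M ζ f) {ι : Type*} (s : Finset ι) (g : ι → M) :
    f (∏ i ∈ s, g i) = ∏ i ∈ s, f (g i) :=
  _root_.map_prod (MonoidHom.mk' f hf.map_mul) g s

/-- The `l`-primary component `x^{e_l}` of an element killed by `N ≠ 0` lies in the pro-`l` portion `M[l]`
(for any topology): `(x^{e_l})^{l^{v_l(N)}} = 1` since `N ∣ e_l · l^{v_l(N)}`.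
[cite: MochizukiFrdI2008, Def. 2.8(ii) p.52] -/
theorem pow_primary_mem_proL {x : M} {N : ℕ} (hx : x ^ N = 1) (l : Nat.Primes) {e : ℕ}
    (he : e ≡ 0 [MOD ordCompl[(l : ℕ)] N]) : x ^ e ∈ proL M l := by
  refine mem_proL_iff.mpr fun U => ⟨N.factorization l, ?_⟩
  have hdvd : N ∣ e * (l : ℕ) ^ N.factorization l := by
    obtain ⟨c, hc⟩ := (Nat.modEq_zero_iff_dvd.mp he)
    refine ⟨c, ?_⟩
    rw [hc, mul_right_comm, mul_comm (ordCompl[(l : ℕ)] N), Nat.ordProj_mul_ordCompl_eq_self]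
  obtain ⟨m, hm⟩ := hdvd
  rw [← pow_mul, hm, pow_mul, hx, one_pow]
  exact U.one_mem

/-- **Raising to the `ζ`-th power on torsion** (Def. 2.8 (iii)): if `f` is "the map given by raising to the
`ζ`-th power" on a commutative topological group `M` (ANY topology) and `x^N = 1`, `N ≠ 0`, then
`f x = x^Z` for every `Z` with `Z ≡ ζ(l) (mod l^{v_l(N)})` for all primes `l` — i.e. `f` acts on the
`N`-torsion by the image of `ζ ∈ Ẑ` in `ℤ/Nℤ`. [cite: MochizukiFrdI2008, Def. 2.8(iii) p.52] -/
theorem IsZetaPowerMap.eq_pow_of_pow_eq_one (hf : IsZetaPowerMap M ζ f) {N : ℕ} (hN : N ≠ 0) {Z : ℕ}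
    (hZ : ∀ l : Nat.Primes, Z ≡ ((ζ l : ℕ+) : ℕ) [MOD ordProj[(l : ℕ)] N]) {x : M} (hx : x ^ N = 1) :
    f x = x ^ Z := by
  classical
  -- primary idempotents modulo `N`
  choose e he using fun l : Nat.Primes => exists_primary_idempotent l.2 N
  set s : Finset Nat.Primes := (N.primeFactors).subtype Nat.Prime with hs
  have hmem : ∀ p : ℕ, p.Prime → p ∣ N → ∃ hp : p.Prime, (⟨p, hp⟩ : Nat.Primes) ∈ s := fun p hp hpN =>
    ⟨hp, Finset.mem_subtype.mpr (Nat.mem_primeFactors.mpr ⟨hp, hpN, hN⟩)⟩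
  -- `x = ∏_l x^{e_l}`
  have hsum : ∑ l ∈ s, e l ≡ 1 [MOD N] := sum_primary_idempotent_modEq_one hN s hmem e (fun l _ => he l)
  have hx_prod : x = ∏ l ∈ s, x ^ e l := by
    rw [Finset.prod_pow_eq_pow_sum, pow_eq_pow_of_modEq_of_pow_eq_one hx hsum, pow_one]
  -- `f (x^{e_l}) = x^{e_l ζ(l)}`
  have hf_l : ∀ l ∈ s, f (x ^ e l) = x ^ (((ζ l : ℕ+) : ℕ) * e l) := by
    intro l _
    rw [hf.eq_pow l _ (pow_primary_mem_proL hx l (he l).2), ← pow_mul, mul_comm]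
  -- `∑_l ζ(l) e_l ≡ Z (mod N)`
  have hZ' : ∑ l ∈ s, ((ζ l : ℕ+) : ℕ) * e l ≡ Z [MOD N] := by
    refine modEq_of_forall_prime hN fun p hp => ?_
    by_cases hpN : p ∣ N
    · obtain ⟨hp', hps⟩ := hmem p hp hpN
      exact (sum_mul_primary_idempotent_modEq hN s e (fun l => ((ζ l : ℕ+) : ℕ)) (fun l _ => he l) hps).trans
        (hZ ⟨p, hp'⟩).symm
    · rw [Nat.factorization_eq_zero_of_not_dvd hpN, pow_zero]
      exact Nat.modEq_one
  calc f x = f (∏ l ∈ s, x ^ e l) := by rw [← hx_prod]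
    _ = ∏ l ∈ s, f (x ^ e l) := hf.map_prod s _
    _ = ∏ l ∈ s, x ^ (((ζ l : ℕ+) : ℕ) * e l) := Finset.prod_congr rfl hf_l
    _ = x ^ ∑ l ∈ s, ((ζ l : ℕ+) : ℕ) * e l := Finset.prod_pow_eq_pow_sum _ _ _
    _ = x ^ Z := pow_eq_pow_of_modEq_of_pow_eq_one hx hZ'

/-- The `ζ`-exponent modulo `N` exists: some `Z : ℕ` with `Z ≡ ζ(l) (mod l^{v_l(N)})` for all primes `l`
(Chinese remainder, `exists_modEq_forall_prime`). [cite: MochizukiFrdI2008, Def. 2.8(iii) p.52] -/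
theorem exists_zetaExponent (ζ : Nat.Primes → ℕ+) (N : ℕ) :
    ∃ Z : ℕ, ∀ l : Nat.Primes, Z ≡ ((ζ l : ℕ+) : ℕ) [MOD ordProj[(l : ℕ)] N] :=
  exists_modEq_forall_prime N fun l => ((ζ l : ℕ+) : ℕ)

/-- At a prime power `N = l^k`, `Z := ζ(l)` satisfies the congruences at EVERY prime (at `q ≠ l` the modulus
`q^{v_q(l^k)} = 1`). [cite: MochizukiFrdI2008, Def. 2.8(iii) p.52] -/
theorem zetaExponent_primePow_modEq (ζ : Nat.Primes → ℕ+) (l : Nat.Primes) (k : ℕ) (q : Nat.Primes) :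
    ((ζ l : ℕ+) : ℕ) ≡ ((ζ q : ℕ+) : ℕ) [MOD ordProj[(q : ℕ)] ((l : ℕ) ^ k)] := by
  by_cases h : (q : ℕ) = l
  · have hq : q = l := Subtype.ext h
    subst hq
    exact Nat.ModEq.refl _
  · have h0 : ((l : ℕ) ^ k).factorization q = 0 := by
      rw [Nat.factorization_pow, Finsupp.smul_apply, Nat.Prime.factorization l.2, Finsupp.single_apply,
        if_neg (Ne.symm h), smul_zero]
    rw [h0, pow_zero]
    exact Nat.modEq_one

omit [TopologicalSpace M] in
/-- **Uniqueness of the action on torsion**: two `ζ`-th power maps (for possibly DIFFERENT topologies on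
`M`) agree on every torsion element. [cite: MochizukiFrdI2008, Def. 2.8(iii) p.52] -/
theorem IsZetaPowerMap.eq_of_pow_eq_one {t₁ t₂ : TopologicalSpace M} {f₁ f₂ : M → M}
    (h₁ : @IsZetaPowerMap M _ t₁ ζ f₁) (h₂ : @IsZetaPowerMap M _ t₂ ζ f₂) {N : ℕ} (hN : N ≠ 0) {x : M}
    (hx : x ^ N = 1) : f₁ x = f₂ x := by
  obtain ⟨Z, hZ⟩ := exists_zetaExponent ζ N
  rw [@IsZetaPowerMap.eq_pow_of_pow_eq_one M _ t₁ ζ f₁ h₁ N hN Z hZ x hx,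
    @IsZetaPowerMap.eq_pow_of_pow_eq_one M _ t₂ ζ f₂ h₂ N hN Z hZ x hx]

end Literature.AlgebraicGeometry.Frobenioids
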